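import Mathlib
import HarnessLib
import Summits.KontsevichZagierPeriods.Zeta5Search.Denom.TwoTaleP15Forms
import Summits.KontsevichZagierPeriods.Zeta5Search.Denom.TwoTaleL720Forms
import Summits.KontsevichZagierPeriods.Zeta5Search.Denom.TwoTaleL720Saving

/-!
# Rung L(7/20) — the inclusion input and the CONDITIONAL measure `μ(ζ(2)) ≤ 1 + (C₁ + 301 − S)/(c − 301 + S)`

HONEST FRAMING: systematic search; no irrationality claim unless certified.  This file claims NO measure of `ζ(2)`: it is
the second half of the L(7/20) twin of `Denom/TwoTaleL25Exponent` (second half of F2), split off so that the head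
`Denom/TwoTaleL720Forms` does not depend on the saving file.  At the ladder point `a = (127n+1, 107n+1, 87n+1, 147n+1)`,
`b = (1, 20n+1, 40n+1, 254n+2)` of [Zudilin2014ZetaTwo, §3] (rung `s = 7/20`, normaliser `D₁₄₇ₙ D₁₅₄ₙ`, joint saving
`Φₙ = savingProduct720 n` with certified rate `S = savingRate720 ∈ [155.35326, 155.35341]`, `Denom/TwoTaleL720SavingEncC`) it
NAMES the inclusion input
* `InclusionL720` — `Φₙ ∣ D₁₄₇ₙD₁₅₄ₙ qₙ` and `Φₙ⁻¹ D₁₄₇ₙD₁₅₄ₙ pₙ ∈ ℤ` for `n ≥ 1` (DISCHARGED by `TwoTaleL720Inclusion`: Lemma 7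
  cells + Lemma 8 cells through the two-tale identity (bmiss) `q = −q̂, p = −p̂` = the tree's `TwoTaleOmega.bmiss_Lad`
  at `Lad(20n, 7n)`),
and PROVES the implication from the named inputs to the measure:
* **`exponentLE_of_inputsL720`**: `InclusionL720 → DecayL720 c → CoeffRateL720 C₁ → 301 − S < c → 0 < C₁ → S < 301 →
  ExponentLE (ζ(2)) (1 + (C₁ + (301 − S))/(c − (301 − S)))`, via the tree's abstract
  `TwoTaleP15Forms.exponentLE_of_normalisedForms` and `irrational_zetaValue_two`;
* **`zetaTwo_exponent_le_L720_of_inputs`**: `InclusionL720 → DecayL720 283.1134 → CoeffRateL720 C₁ → 0 < C₁ → C₁ ≤ 406.88613 →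
  155.35326 ≤ S ≤ 155.35341 → ExponentLE (ζ(2)) 5.0194` (kernel arithmetic: `1 + (406.88613 + 301 − 155.35326)/(283.1134 − 301 +
  155.35326) = 5.019396 ≤ 5.0194`; design value `5.01939129`, fam-measure g8 `rung_cost.log`; the enclosure of `S` is a HYPOTHESIS of
  this file so that the level/inclusion files need not wait for `TwoTaleL720SavingEncA/B/C`).
AN IMPLICATION ONLY; the inputs are the successors' theorems (`TwoTaleL720Inclusion`, `TwoTaleL720Decay`,
`TwoTaleL720GrowthLimit` / `TwoTaleL720GrowthEnclosure`, `TwoTaleL720SavingEncC`) and the capstone is `TwoTaleL720Measure`.  Nothing about `ζ(5)`.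
-/

noncomputable section

open Filter Topology Finset
open Literature.NumberTheory.Transcendental
open Literature.NumberTheory.Irrationality
open Literature.NumberTheory.Irrationality.Zudilin2014
open Summit.KontsevichZagierPeriods.Zeta5Search.Denom.TwoTaleL720Saving
open Summit.KontsevichZagierPeriods.Zeta5Search.Denom.TwoTaleL720Forms

namespace Summit.KontsevichZagierPeriods.Zeta5Search.Denom.TwoTaleL720Exponent

/-! ### The inclusion input -/

/-- **INPUT — inclusion** (Lemma 7 ∪ Lemma 8 ∪ (bmiss) at the point): `Φₙ ∣ D₁₄₇ₙD₁₅₄ₙ qₙ` and `Φₙ⁻¹ D₁₄₇ₙD₁₅₄ₙ pₙ ∈ ℤ`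
for `n ≥ 1`, `Φₙ = savingProduct720 n` (primes `362√n < p ≤ 147n`, digit `ν = max(φ, φ̂)`).  Discharged by the successor
`TwoTaleL720Inclusion`; an input here. -/
@[conjecture] def InclusionL720 : Prop :=
  ∀ n : ℕ, 1 ≤ n →
    (∃ B : ℤ, ((lcmNormaliserL720 n : ℕ) : ℤ) * formQL720 n = (savingProduct720 n : ℤ) * B) ∧
      ∃ A : ℤ, ((lcmNormaliserL720 n : ℕ) : ℚ) * formPL720 n = (savingProduct720 n : ℚ) * A

/-! ### The conditional measure (PROVED implication) -/

/-- The normaliser rate: `(1/n) log (D₁₄₇ₙD₁₅₄ₙ/Φₙ) → 301 − S` (`TwoTaleL720Saving.tendsto_log_lcmNormaliser720_div`). -/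
theorem tendsto_log_lcmNormaliser720_div_savingProduct720 :
    Tendsto (fun n : ℕ => Real.log ((lcmNormaliserL720 n : ℝ) / savingProduct720 n) / n) atTop
      (𝓝 (301 - savingRate720)) := by
  refine tendsto_log_lcmNormaliser720_div.congr fun n => ?_
  simp only [lcmNormaliserL720, Nat.cast_mul]

/-- **The measure at rung L(7/20) from the three inputs (PROVED implication)**, `S = savingRate720`:
`μ(ζ(2)) ≤ 1 + (C₁ + (301 − S))/(c − (301 − S))` in the `ExponentLE` sense. -/
theorem exponentLE_of_inputsL720 {c C₁ : ℝ} (hI : InclusionL720) (hD : DecayL720 c) (hC : CoeffRateL720 C₁)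
    (hc : 301 - savingRate720 < c) (hC₀ : 0 < C₁) (hS : savingRate720 < 301) :
    ExponentLE (zetaValue 2) (1 + (C₁ + (301 - savingRate720)) / (c - (301 - savingRate720))) := by
  choose! B hB using fun n (hn : 1 ≤ n) => (hI n hn).1
  choose! A hA using fun n (hn : 1 ≤ n) => (hI n hn).2
  exact Denom.TwoTaleP15Forms.exponentLE_of_normalisedForms Denom.TwoTaleP15Forms.irrational_zetaValue_two
    lcmNormaliserL720_pos savingProduct720_pos hB hA hD hC tendsto_log_lcmNormaliser720_div_savingProduct720 hc hC₀
    (by linarith)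

/-- **Rung L(7/20), numerically (PROVED implication; the inputs are the successors' theorems, not this file's):**
`c = 283.1134` (`< C₀ = 283.11347336`), `0 < C₁ ≤ 406.88613` and the enclosure `155.35326 ≤ S ≤ 155.35341` (a HYPOTHESIS here,
proved in `TwoTaleL720SavingEncC.savingRate720_bounds`) give **`μ(ζ(2)) ≤ 5.0194`** (design value `5.01939129…`; kernel bound
`5.019396`). -/
theorem zetaTwo_exponent_le_L720_of_inputs {C₁ : ℝ} (hI : InclusionL720) (hD : DecayL720 283.1134)
    (hC : CoeffRateL720 C₁) (hC₀ : 0 < C₁) (hC₁ : C₁ ≤ 406.88613)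
    (hS : (155.35326 : ℝ) ≤ savingRate720 ∧ savingRate720 ≤ 155.35341) : ExponentLE (zetaValue 2) 5.0194 := by
  have h := exponentLE_of_inputsL720 hI hD hC (by linarith [hS.1]) hC₀ (by linarith [hS.2])
  have hden : 0 < 283.1134 - (301 - savingRate720) := by linarith [hS.1]
  have hle : 1 + (C₁ + (301 - savingRate720)) / (283.1134 - (301 - savingRate720)) ≤ 5.0194 := by
    have h1 : (C₁ + (301 - savingRate720)) / (283.1134 - (301 - savingRate720)) ≤ 4.0194 := by
      rw [div_le_iff₀ hden]
      linarith [hS.1]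
    linarith
  exact h.mono hle

end Summit.KontsevichZagierPeriods.Zeta5Search.Denom.TwoTaleL720Exponent

end
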